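import Mathlib
import Literature.Analysis.FluidPDE.VectorCalculus

/-!
# Pointwise Lipschitz dependence of the regularised Biot–Savart integrand

Tools stub `stub_kernelLipschitzPointwise` of line `Sketch` (crux `SkeletonEquilibrium`, thesis
`FilamentSkeletonRss`). For the Rosenhead-regularised Biot–Savart kernel
`K_e(z) = (‖z‖² + e²)^{-3/2}` the integrand `K_e(z) • T × z` depends Lipschitz-continuously on the
pair (tangent `T`, chord `z`), uniformly in the core parameter `e`: if `‖A‖, ‖B‖ ≤ 1`,
`‖a - b‖ ≤ θ`, `‖A - B‖ ≤ θ` and `θ ≤ m := min ‖a‖ ‖b‖`, then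
`‖K_e(a) • A × a - K_e(b) • B × b‖ ≤ θ (13 / m³ + 2 / m²)`.

Proof. If `θ = 0` then `a = b`, `A = B` and both sides vanish. Otherwise `m > 0`; put
`p = √(‖a‖² + e²) ≥ ‖a‖ ≥ m`, `q = √(‖b‖² + e²) ≥ ‖b‖ ≥ m`, so that `K_e(a) = p⁻³`,
`K_e(b) = q⁻³`, and `|p - q| ≤ |‖a‖ - ‖b‖| ≤ θ` (the map `r ↦ √(r² + e²)` is `1`-Lipschitz).
Split `p⁻³ • A × a - q⁻³ • B × b = p⁻³ • (A × a - B × b) + (p⁻³ - q⁻³) • B × b`.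
By bilinearity `A × a - B × b = (A - B) × a + B × (a - b)` has norm `≤ θ ‖a‖ + θ`, and
`p⁻³ (θ ‖a‖ + θ) ≤ θ p⁻² + θ p⁻³ ≤ θ / m² + θ / m³`. For the second term,
`p⁻³ - q⁻³ = (p⁻¹ - q⁻¹)(p⁻² + p⁻¹ q⁻¹ + q⁻²)` with `p⁻² + p⁻¹q⁻¹ + q⁻² ≤ 3 / m²` and
`|p⁻¹ - q⁻¹| ‖b‖ ≤ |p⁻¹ - q⁻¹| q = |q - p| p⁻¹ ≤ θ / m`, whence it is `≤ 3 θ / m³`.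
In total `≤ θ (4 / m³ + 1 / m²) ≤ θ (13 / m³ + 2 / m²)`.
-/

noncomputable section

open MeasureTheory Filter Topology
open Literature.Analysis.FluidPDE

namespace Summit.NavierStokesRegularity.NavierStokesRegularity.Theorems.SkeletonEquilibrium.Sketch
set_option linter.dupNamespace false

/-- `‖v × w‖ ≤ ‖v‖ ‖w‖` (from `norm_cross`, `sin ≤ 1`). [folklore] -/
private theorem klp_norm_cross_le (v w : EuclideanSpace ℝ (Fin 3)) :
    ‖cross v w‖ ≤ ‖v‖ * ‖w‖ := by
  rw [norm_cross]
  exact mul_le_of_le_one_right (by positivity) (Real.sin_le_one _)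

/-- Bilinearity of the cross product: `A × a - B × b = (A - B) × a + B × (a - b)`
(via the bundled bilinear map `crossCLM`). [folklore] -/
private theorem klp_cross_sub_cross (A B a b : EuclideanSpace ℝ (Fin 3)) :
    cross A a - cross B b = cross (A - B) a + cross B (a - b) := by
  show crossCLM A a - crossCLM B b = crossCLM (A - B) a + crossCLM B (a - b)
  rw [map_sub, map_sub, sub_apply]
  abel

/-- `‖A × a - B × b‖ ≤ ‖A - B‖ ‖a‖ + ‖B‖ ‖a - b‖`. [folklore] -/
private theorem klp_norm_cross_sub_cross_le (A B a b : EuclideanSpace ℝ (Fin 3)) :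
    ‖cross A a - cross B b‖ ≤ ‖A - B‖ * ‖a‖ + ‖B‖ * ‖a - b‖ := by
  rw [klp_cross_sub_cross]
  exact (norm_add_le _ _).trans (add_le_add (klp_norm_cross_le _ _) (klp_norm_cross_le _ _))

/-- `x ^ (3/2) = (√x)³` for `0 ≤ x`. [folklore] -/
private theorem klp_rpow_three_halves_eq {x : ℝ} (hx : 0 ≤ x) :
    x ^ (3 / 2 : ℝ) = Real.sqrt x ^ 3 := by
  rw [show (3 / 2 : ℝ) = (1 / 2) * ((3 : ℕ) : ℝ) by norm_num, Real.rpow_mul hx,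
    Real.rpow_natCast, ← Real.sqrt_eq_rpow]

/-- The map `r ↦ √(r² + e²)` is `1`-Lipschitz on `0 ≤ r`:
`|√(r² + e²) - √(s² + e²)| ≤ |r - s|` (Cauchy–Schwarz `r s + e² ≤ √(r² + e²) √(s² + e²)`).
[folklore] -/
private theorem klp_abs_sqrt_sub_sqrt_le (r s e : ℝ) :
    |Real.sqrt (r ^ 2 + e ^ 2) - Real.sqrt (s ^ 2 + e ^ 2)| ≤ |r - s| := by
  have hp2 : Real.sqrt (r ^ 2 + e ^ 2) ^ 2 = r ^ 2 + e ^ 2 := Real.sq_sqrt (by positivity)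
  have hq2 : Real.sqrt (s ^ 2 + e ^ 2) ^ 2 = s ^ 2 + e ^ 2 := Real.sq_sqrt (by positivity)
  have hkey : r * s + e ^ 2 ≤ Real.sqrt (r ^ 2 + e ^ 2) * Real.sqrt (s ^ 2 + e ^ 2) := by
    rw [← Real.sqrt_mul (by positivity)]
    exact Real.le_sqrt_of_sq_le (by nlinarith [sq_nonneg (e * (r - s))])
  refine sq_le_sq.1 ?_
  nlinarith [hkey, hp2, hq2]

/-- Scalar core of the Lipschitz estimate: for `0 < m ≤ p`, `m ≤ q`, `r ≤ q` and
`|p - q| ≤ θ`, `|p⁻³ - q⁻³| r ≤ 3 θ / m³` (factor `p⁻³ - q⁻³ = (p⁻¹ - q⁻¹)(p⁻² + p⁻¹q⁻¹ + q⁻²)`,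
`|p⁻¹ - q⁻¹| q = |q - p| p⁻¹`). [folklore] -/
private theorem klp_scalar_core {m p q r θ : ℝ} (hm : 0 < m) (hmp : m ≤ p) (hmq : m ≤ q)
    (hrq : r ≤ q) (hpq : |p - q| ≤ θ) :
    |(p ^ 3)⁻¹ - (q ^ 3)⁻¹| * r ≤ 3 * θ / m ^ 3 := by
  have hp : 0 < p := hm.trans_le hmp
  have hq : 0 < q := hm.trans_le hmq
  have hu0 : 0 < p⁻¹ := inv_pos.2 hp
  have hv0 : 0 < q⁻¹ := inv_pos.2 hq
  have hum : p⁻¹ ≤ m⁻¹ := inv_anti₀ hm hmp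
  have hvm : q⁻¹ ≤ m⁻¹ := inv_anti₀ hm hmq
  have hθ : 0 ≤ θ := (abs_nonneg _).trans hpq
  have h1 : (p ^ 3)⁻¹ - (q ^ 3)⁻¹ = (p⁻¹ - q⁻¹) * (p⁻¹ ^ 2 + p⁻¹ * q⁻¹ + q⁻¹ ^ 2) := by
    rw [inv_pow, inv_pow]; ring
  have h2 : 0 ≤ p⁻¹ ^ 2 + p⁻¹ * q⁻¹ + q⁻¹ ^ 2 := by positivity
  have h3 : p⁻¹ ^ 2 + p⁻¹ * q⁻¹ + q⁻¹ ^ 2 ≤ 3 * m⁻¹ ^ 2 := by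
    nlinarith [mul_le_mul hum hum hu0.le (hu0.le.trans hum),
      mul_le_mul hum hvm hv0.le (hu0.le.trans hum), mul_le_mul hvm hvm hv0.le (hv0.le.trans hvm)]
  have h4 : |p⁻¹ - q⁻¹| * r ≤ θ * m⁻¹ := by
    have e1 : (p⁻¹ - q⁻¹) * q = (q - p) * p⁻¹ := by
      field_simp
    calc |p⁻¹ - q⁻¹| * r ≤ |p⁻¹ - q⁻¹| * q := mul_le_mul_of_nonneg_left hrq (abs_nonneg _)
      _ = |(p⁻¹ - q⁻¹) * q| := by rw [abs_mul, abs_of_pos hq]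
      _ = |q - p| * p⁻¹ := by rw [e1, abs_mul, abs_of_pos hu0]
      _ ≤ θ * m⁻¹ := by
        rw [abs_sub_comm] at hpq
        exact mul_le_mul hpq hum hu0.le hθ
  calc |(p ^ 3)⁻¹ - (q ^ 3)⁻¹| * r
      = |p⁻¹ - q⁻¹| * r * (p⁻¹ ^ 2 + p⁻¹ * q⁻¹ + q⁻¹ ^ 2) := by
        rw [h1, abs_mul, abs_of_nonneg h2]; ring
    _ ≤ θ * m⁻¹ * (3 * m⁻¹ ^ 2) := mul_le_mul h4 h3 h2 (by positivity)
    _ = 3 * θ / m ^ 3 := by ring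

/-- **Tools stub** (`stub_kernelLipschitzPointwise`): pointwise Lipschitz dependence, uniform in
the core parameter `e`, of the regularised Biot–Savart integrand `K_e(z) • T × z`,
`K_e(z) = (‖z‖² + e²)^{-3/2}`, on the pair (tangent, chord): for `‖A‖, ‖B‖ ≤ 1`,
`‖a - b‖ ≤ θ`, `‖A - B‖ ≤ θ`, `0 ≤ θ ≤ min ‖a‖ ‖b‖ =: m`,
`‖K_e(a) • A × a - K_e(b) • B × b‖ ≤ θ (13 / m³ + 2 / m²)`. [folklore] -/
theorem stub_kernelLipschitzPointwise :
    ∀ (e θ : ℝ) (a b A B : EuclideanSpace ℝ (Fin 3)),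
      e ≠ 0 → 0 ≤ θ → θ ≤ ‖a‖ → θ ≤ ‖b‖ → ‖A‖ ≤ 1 → ‖B‖ ≤ 1 → ‖a - b‖ ≤ θ → ‖A - B‖ ≤ θ →
      ‖((‖a‖ ^ 2 + e ^ 2) ^ (3 / 2 : ℝ))⁻¹ • cross A a - ((‖b‖ ^ 2 + e ^ 2) ^ (3 / 2 : ℝ))⁻¹ • cross B b‖
        ≤ θ * (13 / min ‖a‖ ‖b‖ ^ 3 + 2 / min ‖a‖ ‖b‖ ^ 2) := by
  intro e θ a b A B _he hθ hθa hθb _hA hB hab hAB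
  rcases hθ.eq_or_lt with hθ0 | hθpos
  · -- `θ = 0`: then `a = b`, `A = B`, and both sides vanish.
    subst hθ0
    have hab' : a - b = 0 := norm_le_zero_iff.1 hab
    have hAB' : A - B = 0 := norm_le_zero_iff.1 hAB
    rw [sub_eq_zero] at hab' hAB'
    subst hab' hAB'
    simp
  · -- `θ > 0`: all radii are positive.
    have hra0 : 0 < ‖a‖ := hθpos.trans_le hθa
    have hrb0 : 0 < ‖b‖ := hθpos.trans_le hθb
    have hKa : ((‖a‖ ^ 2 + e ^ 2) ^ (3 / 2 : ℝ))⁻¹ = (Real.sqrt (‖a‖ ^ 2 + e ^ 2) ^ 3)⁻¹ := by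
      rw [klp_rpow_three_halves_eq (by positivity)]
    have hKb : ((‖b‖ ^ 2 + e ^ 2) ^ (3 / 2 : ℝ))⁻¹ = (Real.sqrt (‖b‖ ^ 2 + e ^ 2) ^ 3)⁻¹ := by
      rw [klp_rpow_three_halves_eq (by positivity)]
    have hrap : ‖a‖ ≤ Real.sqrt (‖a‖ ^ 2 + e ^ 2) :=
      Real.le_sqrt_of_sq_le (by nlinarith [sq_nonneg e])
    have hrbq : ‖b‖ ≤ Real.sqrt (‖b‖ ^ 2 + e ^ 2) :=
      Real.le_sqrt_of_sq_le (by nlinarith [sq_nonneg e])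
    have hpq : |Real.sqrt (‖a‖ ^ 2 + e ^ 2) - Real.sqrt (‖b‖ ^ 2 + e ^ 2)| ≤ θ :=
      (klp_abs_sqrt_sub_sqrt_le _ _ e).trans ((abs_norm_sub_norm_le a b).trans hab)
    rw [hKa, hKb]
    set p := Real.sqrt (‖a‖ ^ 2 + e ^ 2) with hp
    set q := Real.sqrt (‖b‖ ^ 2 + e ^ 2) with hq
    set m := min ‖a‖ ‖b‖ with hm
    have hm0 : 0 < m := lt_min hra0 hrb0
    have hmp : m ≤ p := (min_le_left _ _).trans hrap
    have hmq : m ≤ q := (min_le_right _ _).trans hrbq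
    have hp0 : 0 < p := hm0.trans_le hmp
    have hKa0 : 0 < (p ^ 3)⁻¹ := by positivity
    have hsplit : (p ^ 3)⁻¹ • cross A a - (q ^ 3)⁻¹ • cross B b
        = (p ^ 3)⁻¹ • (cross A a - cross B b) + ((p ^ 3)⁻¹ - (q ^ 3)⁻¹) • cross B b := by
      rw [smul_sub, sub_smul]; abel
    rw [hsplit]
    -- First term: `p⁻³ ‖A × a - B × b‖ ≤ p⁻³ (θ ‖a‖ + θ) ≤ θ / m² + θ / m³`.
    have hT1 : ‖(p ^ 3)⁻¹ • (cross A a - cross B b)‖ ≤ θ / m ^ 2 + θ / m ^ 3 := by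
      rw [norm_smul, Real.norm_eq_abs, abs_of_pos hKa0]
      calc (p ^ 3)⁻¹ * ‖cross A a - cross B b‖
          ≤ (p ^ 3)⁻¹ * (θ * ‖a‖ + θ) := by
            refine mul_le_mul_of_nonneg_left ?_ hKa0.le
            calc ‖cross A a - cross B b‖ ≤ ‖A - B‖ * ‖a‖ + ‖B‖ * ‖a - b‖ :=
                  klp_norm_cross_sub_cross_le A B a b
              _ ≤ θ * ‖a‖ + 1 * θ :=
                  add_le_add (mul_le_mul_of_nonneg_right hAB (norm_nonneg _))
                    (mul_le_mul hB hab (norm_nonneg _) zero_le_one)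
              _ = θ * ‖a‖ + θ := by ring
        _ = θ * (‖a‖ * (p ^ 3)⁻¹) + θ * (p ^ 3)⁻¹ := by ring
        _ ≤ θ * (m ^ 2)⁻¹ + θ * (m ^ 3)⁻¹ := by
            refine add_le_add (mul_le_mul_of_nonneg_left ?_ hθ) (mul_le_mul_of_nonneg_left
              (inv_anti₀ (by positivity) (pow_le_pow_left₀ hm0.le hmp 3)) hθ)
            calc ‖a‖ * (p ^ 3)⁻¹ ≤ p * (p ^ 3)⁻¹ := mul_le_mul_of_nonneg_right hrap hKa0.le
              _ = (p ^ 2)⁻¹ := by field_simp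
              _ ≤ (m ^ 2)⁻¹ := inv_anti₀ (by positivity) (pow_le_pow_left₀ hm0.le hmp 2)
        _ = θ / m ^ 2 + θ / m ^ 3 := by rw [div_eq_mul_inv, div_eq_mul_inv]
    -- Second term: `|p⁻³ - q⁻³| ‖B × b‖ ≤ |p⁻³ - q⁻³| ‖b‖ ≤ 3 θ / m³`.
    have hT2 : ‖((p ^ 3)⁻¹ - (q ^ 3)⁻¹) • cross B b‖ ≤ 3 * θ / m ^ 3 := by
      rw [norm_smul, Real.norm_eq_abs]
      calc |(p ^ 3)⁻¹ - (q ^ 3)⁻¹| * ‖cross B b‖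
          ≤ |(p ^ 3)⁻¹ - (q ^ 3)⁻¹| * ‖b‖ := by
            refine mul_le_mul_of_nonneg_left ?_ (abs_nonneg _)
            calc ‖cross B b‖ ≤ ‖B‖ * ‖b‖ := klp_norm_cross_le B b
              _ ≤ 1 * ‖b‖ := mul_le_mul_of_nonneg_right hB (norm_nonneg _)
              _ = ‖b‖ := one_mul _
        _ ≤ 3 * θ / m ^ 3 := klp_scalar_core hm0 hmp hmq hrbq hpq
    calc ‖(p ^ 3)⁻¹ • (cross A a - cross B b) + ((p ^ 3)⁻¹ - (q ^ 3)⁻¹) • cross B b‖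
        ≤ ‖(p ^ 3)⁻¹ • (cross A a - cross B b)‖ + ‖((p ^ 3)⁻¹ - (q ^ 3)⁻¹) • cross B b‖ :=
          norm_add_le _ _
      _ ≤ (θ / m ^ 2 + θ / m ^ 3) + 3 * θ / m ^ 3 := add_le_add hT1 hT2
      _ ≤ θ * (13 / m ^ 3 + 2 / m ^ 2) := by
          have h1 : 0 ≤ θ / m ^ 3 := by positivity
          have h2 : 0 ≤ θ / m ^ 2 := by positivity
          have e1 : θ * (13 / m ^ 3 + 2 / m ^ 2) = 13 * (θ / m ^ 3) + 2 * (θ / m ^ 2) := by ring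
          have e2 : 3 * θ / m ^ 3 = 3 * (θ / m ^ 3) := by ring
          rw [e1, e2]
          linarith

end Summit.NavierStokesRegularity.NavierStokesRegularity.Theorems.SkeletonEquilibrium.Sketch
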